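import Summits.NavierStokesRegularity.NavierStokesRegularity.Theses.LocalPressureProfileDoor
import Summits.NavierStokesRegularity.NavierStokesRegularity.Theorems.FastClassSqueeze.Negative.KinematicBlob
import Literature.Analysis.FluidPDE.TsaiLocalEnergy
import Literature.Analysis.FluidPDE.PineauVicolLerayPressure

/-!
# `MonotonePressureProfileRigidity` (crux K2⁺, stmt-NavierStokesRegularity-20180, route
# LocalPressureProfileDoor): the Navier–Stokes (Oseen–Duhamel) hypothesis is load-bearing —
# negative-side support (refuter, critic seat ns-typeII-critic-2)

Sorry-free lemmas about the crux
`Summit.NavierStokesRegularity.NavierStokesRegularity.Theses.LocalPressureProfileDoor.MonotonePressureProfileRigidity`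
("a door-class profile — Type I in time, space–time Type-I decay, continuous on the open past slab,
unit-viscosity Oseen-mild, divergence-free slices — whose similarity Riesz pressure
`P(t,y) = (−t)·Q[v(t)](√(−t)y)` is non-increasing along the shifts `t ↦ e^(−σ)t` is not backward-singular
at the apex"), for ideators, planners and provers to IMPORT (no `def`; the witness is assembled from tree
objects):

* §1 THE KINEMATIC WITNESS: the exactly self-similar collapse `v(t,x) = (−t)^{−1/2} U((−t)^{−1/2} x)` of the
  tree's compactly supported, smooth, divergence-free `biaxProfile U` (`= (x₀, x₁, −2x₂)` on the unit ball;
  file `Theorems/FastClassSqueeze/Negative/KinematicBlob.lean`), written with the tree's `blobSlice c =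
  c • U(c ·)` as the family `t ↦ blobSlice (√(−t))⁻¹`.  It has the space–time Type-I decay
  `‖v(t,x)‖ ≤ C_d/(‖x‖ + √(−t))` (`hasTypeIDecay_selfSimilarBlob`, from the profile bound
  `‖U(y)‖ ≤ C_d/(1 + ‖y‖)`, `exists_decay_biaxProfile`), hence the Type-I rate; it is jointly continuous
  on the open slab, divergence free on every slice, and BACKWARD-SINGULAR at the origin
  (`isBackwardSingularPoint_selfSimilarBlob`: norm `1/(2√τ)` at the continuity points `(−τ, √τ·½e₀)`,
  tree `isBackwardSingularPoint_of_forall_exists_continuousAt`); and by the dilation covariance of the Riesz pressure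
  (`PineauVicol2026.pressurePotential_smul_comp_smul`) its similarity pressure is CONSTANT in time:
  `(−t)·Q[v(t)](√(−t)y) = Q[U](y)` (`similarityPressure_selfSimilarBlob`), so the shift-monotonicity
  hypothesis of the crux holds with equality (`pressureShift_le_selfSimilarBlob`).
* §2 LOAD-BEARING HYPOTHESIS: `monotonePressureProfileRigidity_false_without_mild` — the crux with ONLY the
  Oseen–Duhamel identity `v t = e^{(t−s)Δ} v s − B¹_s(v,v)(t)` dropped (keep the Type-I rate, the space–time
  decay, joint continuity, `div v(t) = 0` and the non-increasing similarity pressure) is FALSE; and so is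
  the variant with CONSTANT similarity pressure (`…_false_without_mild_of_constant_pressure`), the
  strongest form of the pressure hypothesis.  So K2⁺ is NOT a statement about kinematics plus a one-sided
  pressure budget at the Type-I rate: any proof must use the Navier–Stokes dynamics (which the witness
  violates — an exactly self-similar mild profile with this decay is zero by Tsai 1998 / NRŠ 1996).

Summary for provers: the dynamics is load-bearing and enters only through the mild identity; a
refutation of the crux AS TYPED needs a backward-singular, space–time Type-I, Oseen-mild ancient flow —
a Type-I blow-up profile — with non-increasing similarity pressure; none is known (steady profiles:
Tsai 1998; DSS near-steady: Chae–Wolf 2017), so the crux is irrefutable by any construction in print.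

## References

* T.-P. Tsai, *On Leray's self-similar solutions of the Navier–Stokes equations satisfying local energy
  estimates*, Arch. Ration. Mech. Anal. 143 (1998) 29–51, Thm. 1. [Tsai1998]
* J. Nečas, M. Růžička, V. Šverák, Acta Math. 176 (1996) 283–294. [NecasRuzickaSverak1996]
* B. Pineau, V. Vicol, arXiv:2607.09619 (2026), Lemma 7.1 (pressure in Leray variables). [PineauVicol2026]
* G. Koch, N. Nadirashvili, G. Seregin, V. Šverák, Acta Math. 203 (2009) 83–105, (1.4)–(1.6). [KNSS2009]
-/

noncomputable section

open Set Filter Function MeasureTheory Metric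
open scoped Topology ENNReal NNReal
open Literature.Analysis.FluidPDE Literature.Analysis.UnboundedOperators
open Summit.NavierStokesRegularity.NavierStokesRegularity.Theses.LocalPressureProfileDoor
open Summit.NavierStokesRegularity.NavierStokesRegularity.Theorems.FastClassSqueeze.Negative

-- the summit and its single problem share the name `NavierStokesRegularity` (D-0017 nested layout)
set_option linter.dupNamespace false

namespace Summit.NavierStokesRegularity.NavierStokesRegularity.Theorems.MonotonePressureProfileRigidity.Negative

/-! ## §1 The kinematic witness: the self-similar collapse of the `biaxProfile` -/

/-- The compactly supported smooth profile `U = biaxProfile` lies in the decay class of the Riesz-pressure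
calculus: `‖U(y)‖ ≤ C_d/(1 + ‖y‖)` with `C_d = M(1 + R) ≥ 0` (`M` a sup bound, `R` a support radius).
[folklore] -/
theorem exists_decay_biaxProfile :
    ∃ Cd : ℝ, 0 ≤ Cd ∧ ∀ y : EuclideanSpace ℝ (Fin 3), ‖biaxProfile y‖ ≤ Cd / (1 + ‖y‖) := by
  obtain ⟨M, hM⟩ := exists_bound_biaxProfile
  have hM0 : 0 ≤ M := (norm_nonneg _).trans (hM 0)
  obtain ⟨R, hR⟩ :=
    (hasCompactSupport_biaxProfile.isCompact.isBounded).subset_closedBall (0 : EuclideanSpace ℝ (Fin 3))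
  refine ⟨M * (1 + max R 0), by positivity, fun y => ?_⟩
  rw [le_div_iff₀ (by positivity)]
  by_cases hy : y ∈ tsupport biaxProfile
  · have hyR : ‖y‖ ≤ max R 0 := by
      have h := hR hy
      rw [mem_closedBall, dist_zero_right] at h
      exact h.trans (le_max_left _ _)
    exact mul_le_mul (hM y) (by linarith) (by positivity) hM0
  · rw [image_eq_zero_of_notMem_tsupport hy, norm_zero, zero_mul]
    positivity

/-- Space–time decay of a dilated slice: `‖c U(c x)‖ ≤ C_d/(‖x‖ + c⁻¹)` for `c > 0`. [folklore] -/
theorem norm_blobSlice_le {Cd : ℝ} (hCd : ∀ y : EuclideanSpace ℝ (Fin 3), ‖biaxProfile y‖ ≤ Cd / (1 + ‖y‖))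
    {c : ℝ} (hc : 0 < c) (x : EuclideanSpace ℝ (Fin 3)) :
    ‖blobSlice c x‖ ≤ Cd / (‖x‖ + c⁻¹) := by
  show ‖c • biaxProfile (c • x)‖ ≤ _
  rw [norm_smul, Real.norm_of_nonneg hc.le]
  have h := hCd (c • x)
  rw [norm_smul, Real.norm_of_nonneg hc.le] at h
  have h1 : (‖x‖ + c⁻¹) ≠ 0 := by positivity
  have h2 : (1 + c * ‖x‖) ≠ 0 := by positivity
  have e : Cd / (‖x‖ + c⁻¹) = c * (Cd / (1 + c * ‖x‖)) := by
    field_simp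
    ring
  rw [e]
  exact mul_le_mul_of_nonneg_left h hc.le

/-- Every dilated slice `c U(c ·)` is divergence free (`div (c U(c ·)) = c² (div U)(c ·) = 0`). [folklore] -/
theorem isDivFree_blobSlice (c : ℝ) : VectorCalculus.IsDivFree (blobSlice c) := fun x => by
  show VectorCalculus.divergence (fun y => c • biaxProfile (c • y)) x = 0
  rw [divergence_smul_comp_smul, divergence_biaxProfile, mul_zero]

/-- Dilation covariance of the Riesz pressure on the slices: `Q[c U(c ·)](w) = c² Q[U](c w)`, `c > 0`
(Pineau–Vicol 2026, Lemma 7.1; tree `pressurePotential_smul_comp_smul`). [cite: PineauVicol2026, Lemma 7.1] -/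
theorem pressurePotential_blobSlice {Cd : ℝ}
    (hCd : ∀ y : EuclideanSpace ℝ (Fin 3), ‖biaxProfile y‖ ≤ Cd / (1 + ‖y‖)) {c : ℝ} (hc : 0 < c)
    (w : EuclideanSpace ℝ (Fin 3)) :
    pressurePotential (blobSlice c) w = c ^ 2 * pressurePotential biaxProfile (c • w) :=
  PineauVicol2026.pressurePotential_smul_comp_smul (by exact_mod_cast (contDiff_biaxProfile (n := 2))) hCd hc w

/-- **The similarity pressure of the self-similar collapse is constant in time**:
`(−t)·Q[v(t)](√(−t) y) = Q[U](y)` for `v(t) = (−t)^{−1/2} U((−t)^{−1/2} ·)`, `t < 0`. [folklore] -/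
theorem similarityPressure_selfSimilarBlob {Cd : ℝ}
    (hCd : ∀ y : EuclideanSpace ℝ (Fin 3), ‖biaxProfile y‖ ≤ Cd / (1 + ‖y‖)) {t : ℝ} (ht : t < 0)
    (y : EuclideanSpace ℝ (Fin 3)) :
    (-t) * pressurePotential (blobSlice (Real.sqrt (-t))⁻¹) (Real.sqrt (-t) • y) =
      pressurePotential biaxProfile y := by
  have hs : 0 < Real.sqrt (-t) := Real.sqrt_pos.2 (by linarith)
  rw [pressurePotential_blobSlice hCd (inv_pos.2 hs), smul_smul, inv_mul_cancel₀ hs.ne', one_smul, inv_pow,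
    Real.sq_sqrt (by linarith : (0 : ℝ) ≤ -t), ← mul_assoc, mul_inv_cancel₀ (by linarith : (-t) ≠ 0), one_mul]

/-- The shift-monotonicity hypothesis of the crux holds — with equality — along the self-similar collapse.
[folklore] -/
theorem pressureShift_le_selfSimilarBlob {Cd : ℝ}
    (hCd : ∀ y : EuclideanSpace ℝ (Fin 3), ‖biaxProfile y‖ ≤ Cd / (1 + ‖y‖)) :
    ∀ t < (0 : ℝ), ∀ σ ∈ Icc (0 : ℝ) 1, ∀ y : EuclideanSpace ℝ (Fin 3),
      (-(Real.exp (-σ) * t)) *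
          pressurePotential (blobSlice (Real.sqrt (-(Real.exp (-σ) * t)))⁻¹)
            (Real.sqrt (-(Real.exp (-σ) * t)) • y) ≤
        (-t) * pressurePotential (blobSlice (Real.sqrt (-t))⁻¹) (Real.sqrt (-t) • y) := by
  intro t ht σ _ y
  have ht' : Real.exp (-σ) * t < 0 := mul_neg_of_pos_of_neg (Real.exp_pos _) ht
  rw [similarityPressure_selfSimilarBlob hCd ht' y, similarityPressure_selfSimilarBlob hCd ht y]

/-- The similarity pressure is in fact CONSTANT along the shifts. [folklore] -/
theorem pressureShift_eq_selfSimilarBlob {Cd : ℝ}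
    (hCd : ∀ y : EuclideanSpace ℝ (Fin 3), ‖biaxProfile y‖ ≤ Cd / (1 + ‖y‖)) :
    ∀ t < (0 : ℝ), ∀ σ ∈ Icc (0 : ℝ) 1, ∀ y : EuclideanSpace ℝ (Fin 3),
      (-(Real.exp (-σ) * t)) *
          pressurePotential (blobSlice (Real.sqrt (-(Real.exp (-σ) * t)))⁻¹)
            (Real.sqrt (-(Real.exp (-σ) * t)) • y) =
        (-t) * pressurePotential (blobSlice (Real.sqrt (-t))⁻¹) (Real.sqrt (-t) • y) := by
  intro t ht σ _ y
  have ht' : Real.exp (-σ) * t < 0 := mul_neg_of_pos_of_neg (Real.exp_pos _) ht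
  rw [similarityPressure_selfSimilarBlob hCd ht' y, similarityPressure_selfSimilarBlob hCd ht y]

/-- Space–time Type-I decay of the self-similar collapse: `‖v(t,x)‖ ≤ C_d/(‖x‖ + √(−t))`
(KNSS 2009, (1.6)). [folklore] -/
theorem hasTypeIDecay_selfSimilarBlob {Cd : ℝ}
    (hCd : ∀ y : EuclideanSpace ℝ (Fin 3), ‖biaxProfile y‖ ≤ Cd / (1 + ‖y‖)) :
    HasTypeIDecay Cd (fun t : ℝ => blobSlice (Real.sqrt (-t))⁻¹) := by
  intro t ht x
  have hs : 0 < Real.sqrt (-t) := Real.sqrt_pos.2 (by linarith)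
  have h := norm_blobSlice_le hCd (inv_pos.2 hs) x
  rwa [inv_inv] at h

/-- The self-similar collapse is jointly continuous on the open past slab. [folklore] -/
theorem continuousOn_selfSimilarBlob :
    ContinuousOn (uncurry fun t : ℝ => blobSlice (Real.sqrt (-t))⁻¹) (Iio (0 : ℝ) ×ˢ univ) := by
  have h1 : ContinuousOn (fun z : ℝ × EuclideanSpace ℝ (Fin 3) => (Real.sqrt (-z.1))⁻¹)
      (Iio (0 : ℝ) ×ˢ univ) := by
    refine ContinuousOn.inv₀ ?_ fun z hz => (Real.sqrt_pos.2 ?_).ne'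
    · exact (Real.continuous_sqrt.comp (continuous_neg.comp continuous_fst)).continuousOn
    · have h : z.1 < 0 := hz.1
      linarith
  have hU : Continuous biaxProfile := (contDiff_biaxProfile (n := 0)).continuous
  exact h1.smul (hU.comp_continuousOn (h1.smul continuousOn_snd))

/-- On the axis point `y₀ = ½e₀` of the unit ball the profile is the strain: `U(y₀) = B y₀ = y₀`.
[folklore] -/
theorem biaxProfile_half_ex :
    biaxProfile ((1 / 2 : ℝ) • ex) = (1 / 2 : ℝ) • ex := by
  have hy : (1 / 2 : ℝ) • ex ∈ ball (0 : EuclideanSpace ℝ (Fin 3)) 1 := by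
    rw [mem_ball, dist_zero_right, norm_smul, show ‖ex‖ = 1 by simp [ex]]
    norm_num
  have h2 : ((1 / 2 : ℝ) • ex) 2 = 0 := by simp [ex]
  rw [biaxProfile_of_mem_ball hy, strainB_apply, h2, mul_zero, zero_smul, sub_zero]

/-- **The self-similar collapse is backward-singular at the origin**: along the parabola
`(−τ, √τ·½e₀)` (inside every `Q_r(0,0)` for small `τ`) it is continuous and has norm `1/(2√τ) → ∞`
(tree `isBackwardSingularPoint_of_forall_exists_continuousAt`). [folklore] -/
theorem isBackwardSingularPoint_selfSimilarBlob :
    IsBackwardSingularPoint (fun t : ℝ => blobSlice (Real.sqrt (-t))⁻¹) 0 := by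
  refine isBackwardSingularPoint_of_forall_exists_continuousAt fun r hr M => ?_
  set K : ℝ := |M| + 1 with hK
  have hK0 : 0 < K := by positivity
  have hMK : M < K := by
    have := le_abs_self M
    linarith
  set τ : ℝ := min (r ^ 2 / 2) ((4 * K)⁻¹ ^ 2) with hτ
  have hτpos : 0 < τ := lt_min (by positivity) (by positivity)
  have hτr : τ < r ^ 2 := (min_le_left _ _).trans_lt (by nlinarith)
  have hsq : 0 < Real.sqrt τ := Real.sqrt_pos.2 hτpos
  have hsτ : Real.sqrt τ ≤ (4 * K)⁻¹ :=
    calc Real.sqrt τ ≤ Real.sqrt ((4 * K)⁻¹ ^ 2) := Real.sqrt_le_sqrt (min_le_right _ _)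
      _ = (4 * K)⁻¹ := Real.sqrt_sq (by positivity)
  have hex : ‖(ex : EuclideanSpace ℝ (Fin 3))‖ = 1 := by simp [ex]
  have hy0 : ‖(1 / 2 : ℝ) • (ex : EuclideanSpace ℝ (Fin 3))‖ = 1 / 2 := by
    rw [norm_smul, hex]
    norm_num
  refine ⟨(-τ, Real.sqrt τ • ((1 / 2 : ℝ) • ex)), ?_, ?_, ?_⟩
  · rw [mem_parabolicCylinder]
    refine ⟨⟨?_, ?_⟩, ?_⟩
    · simp only [Prod.fst_zero]
      linarith
    · simp only [Prod.fst_zero]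
      linarith
    · simp only [Prod.snd_zero, dist_zero_right]
      rw [norm_smul, Real.norm_of_nonneg hsq.le, hy0]
      have h : Real.sqrt τ < r := by
        rw [Real.sqrt_lt' hr]
        exact hτr
      linarith
  · exact continuousOn_selfSimilarBlob.continuousAt
      ((isOpen_Iio.prod isOpen_univ).mem_nhds (mk_mem_prod (mem_Iio.2 (by linarith)) (mem_univ _)))
  · show M < ‖(Real.sqrt (-(-τ)))⁻¹ •
        biaxProfile ((Real.sqrt (-(-τ)))⁻¹ • (Real.sqrt τ • ((1 / 2 : ℝ) • ex)))‖
    rw [neg_neg, smul_smul, inv_mul_cancel₀ hsq.ne', one_smul, biaxProfile_half_ex, norm_smul, norm_inv,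
      Real.norm_of_nonneg hsq.le, hy0]
    have h1 : 4 * K ≤ (Real.sqrt τ)⁻¹ := (le_inv_comm₀ (by positivity) hsq).2 hsτ
    nlinarith

/-! ## §2 The Navier–Stokes (Oseen–Duhamel) hypothesis is load-bearing -/

/-- **`MonotonePressureProfileRigidity` minus the mild identity is FALSE.**  Drop ONLY the Oseen–Duhamel
hypothesis `v t = e^{(t−s)Δ} v s − B¹_s(v,v)(t)` of the crux and keep the Type-I rate, the space–time Type-I
decay, joint continuity on the open past slab, `div v(t) = 0` and the shift-monotonicity of the similarity
Riesz pressure `(−e^{−σ}t)·Q[v(e^{−σ}t)](√(−e^{−σ}t) y) ≤ (−t)·Q[v(t)](√(−t) y)`: the resulting statement fails,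
witnessed by the self-similar collapse `v(t,x) = (−t)^{−1/2} U((−t)^{−1/2} x)` of the tree's `biaxProfile`
(decay `hasTypeIDecay_selfSimilarBlob`, continuity `continuousOn_selfSimilarBlob`, `isDivFree_blobSlice`,
constant similarity pressure `pressureShift_le_selfSimilarBlob`, singular apex
`isBackwardSingularPoint_selfSimilarBlob`).  Hence any proof of the crux must use the Navier–Stokes
dynamics. [folklore] -/
theorem monotonePressureProfileRigidity_false_without_mild :
    ¬ ∀ (C D : ℝ) (v : ℝ → EuclideanSpace ℝ (Fin 3) → EuclideanSpace ℝ (Fin 3)),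
        HasTypeITimeDecay C v → HasTypeIDecay D v →
        ContinuousOn (uncurry v) (Iio (0 : ℝ) ×ˢ univ) →
        (∀ t < 0, VectorCalculus.IsDivFree (v t)) →
        (∀ t < 0, ∀ σ ∈ Icc (0 : ℝ) 1, ∀ y : EuclideanSpace ℝ (Fin 3),
          (-(Real.exp (-σ) * t)) *
              pressurePotential (v (Real.exp (-σ) * t)) (Real.sqrt (-(Real.exp (-σ) * t)) • y) ≤
            (-t) * pressurePotential (v t) (Real.sqrt (-t) • y)) →
        ¬ IsBackwardSingularPoint v 0 := by
  intro h
  obtain ⟨Cd, hCd0, hCd⟩ := exists_decay_biaxProfile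
  exact h Cd Cd (fun t : ℝ => blobSlice (Real.sqrt (-t))⁻¹)
    ((hasTypeIDecay_selfSimilarBlob hCd).hasTypeITimeDecay hCd0) (hasTypeIDecay_selfSimilarBlob hCd)
    continuousOn_selfSimilarBlob (fun t _ => isDivFree_blobSlice _) (pressureShift_le_selfSimilarBlob hCd)
    isBackwardSingularPoint_selfSimilarBlob

/-- **Even CONSTANT similarity pressure does not help without the dynamics**: the crux minus the mild
identity stays false when the shift-monotonicity `≤` is strengthened to equality (the self-similar pressure
`P(s,y)` independent of `s`, the strongest one-sided budget) — same witness. [folklore] -/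
theorem monotonePressureProfileRigidity_false_without_mild_of_constant_pressure :
    ¬ ∀ (C D : ℝ) (v : ℝ → EuclideanSpace ℝ (Fin 3) → EuclideanSpace ℝ (Fin 3)),
        HasTypeITimeDecay C v → HasTypeIDecay D v →
        ContinuousOn (uncurry v) (Iio (0 : ℝ) ×ˢ univ) →
        (∀ t < 0, VectorCalculus.IsDivFree (v t)) →
        (∀ t < 0, ∀ σ ∈ Icc (0 : ℝ) 1, ∀ y : EuclideanSpace ℝ (Fin 3),
          (-(Real.exp (-σ) * t)) *
              pressurePotential (v (Real.exp (-σ) * t)) (Real.sqrt (-(Real.exp (-σ) * t)) • y) =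
            (-t) * pressurePotential (v t) (Real.sqrt (-t) • y)) →
        ¬ IsBackwardSingularPoint v 0 := by
  intro h
  obtain ⟨Cd, hCd0, hCd⟩ := exists_decay_biaxProfile
  exact h Cd Cd (fun t : ℝ => blobSlice (Real.sqrt (-t))⁻¹)
    ((hasTypeIDecay_selfSimilarBlob hCd).hasTypeITimeDecay hCd0) (hasTypeIDecay_selfSimilarBlob hCd)
    continuousOn_selfSimilarBlob (fun t _ => isDivFree_blobSlice _) (pressureShift_eq_selfSimilarBlob hCd)
    isBackwardSingularPoint_selfSimilarBlob

/-- The hypotheses KEPT in `monotonePressureProfileRigidity_false_without_mild` are exactly those of the crux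
minus the mild identity: the crux is equivalent to its own statement with the Oseen–Duhamel hypothesis
listed LAST (a reordering, recorded so that the audit can read "crux = kinematic part + mild identity").
[folklore] -/
theorem monotonePressureProfileRigidity_iff_mild_last :
    MonotonePressureProfileRigidity ↔
      ∀ (C D : ℝ) (v : ℝ → EuclideanSpace ℝ (Fin 3) → EuclideanSpace ℝ (Fin 3)),
        HasTypeITimeDecay C v → HasTypeIDecay D v →
        ContinuousOn (uncurry v) (Iio (0 : ℝ) ×ˢ univ) →
        (∀ t < 0, VectorCalculus.IsDivFree (v t)) →
        (∀ t < 0, ∀ σ ∈ Icc (0 : ℝ) 1, ∀ y : EuclideanSpace ℝ (Fin 3),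
          (-(Real.exp (-σ) * t)) *
              pressurePotential (v (Real.exp (-σ) * t)) (Real.sqrt (-(Real.exp (-σ) * t)) • y) ≤
            (-t) * pressurePotential (v t) (Real.sqrt (-t) • y)) →
        (∀ s t : ℝ, s < t → t < 0 → ∀ x,
          v t x = heatExtension (v s) (t - s) x - oseenDuhamel 1 s v v t x) →
        ¬ IsBackwardSingularPoint v 0 :=
  ⟨fun h C D v h1 h2 h3 h4 h5 h6 => h C D v h1 h2 h3 h6 h4 h5,
    fun h C D v h1 h2 h3 h6 h4 h5 => h C D v h1 h2 h3 h4 h5 h6⟩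

end Summit.NavierStokesRegularity.NavierStokesRegularity.Theorems.MonotonePressureProfileRigidity.Negative

end
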